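import Summits.CriticalPhenomena.PercolationContinuityZ3.Theorems.PercNearOneGluingNoHeavyQuantShapeHubLaws
import Summits.CriticalPhenomena.PercolationContinuityZ3.Theorems.PercNearOneGluingNoHeavyQuantNearRouteShape
import Summits.CriticalPhenomena.PercolationContinuityZ3.Theorems.PercNearOneGluingNoHeavyQuantSubfloorHubGeneral
import HarnessLib

/-!
# QUANT lane R8, T-DEC: THE SUB-FLOOR HUB OF EVERY WIDTH FOR A GENERAL PIECE SHAPE `{lo, lo+K; γ}` WITH `lo < K ≤ 3lo/2` — `S(γ₁) ∗ … ∗ S(γ_j)` is SDEC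
# for EVERY `j ≥ 2` whenever `lo ≤ Kγᵢ` (far-giant pieces), `γᵢ < 1`, `x(lo+K) ≤ lo + Kγᵢ` (census-1 gen 31; shape-general form of `sdec_cHub`)

builds on p205010 (kernel theorem, internal audit signed; external expert review pending)

Support file (`--supports stmt-CriticalPhenomena-4575`), QUANT lane seat prim-quant-census-1 (gen 31); memo
`run/shared/lean/prim/quant/prim-quant-census-1/g31/HUB-GENERAL-G31.md` §3.  Theorems only (no definitions), standard axioms, no sorries.  Uses
`sHub` / `sHub_laws` / `sHub_struct` (`…QuantShapeHubLaws`), `sdec_progressionLK` (`…QuantNearRouteShape`), `choose_ge_of_between` (`…QuantSubfloorHubGeneral`).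

THE SHAPES.  `S(γ) = {lo: 1−γ, lo+K: γ}` is the far-giant piece of the glued sibling `R^lo[q](R^K[g])` (`lo` root relays, a glued block of `K`); the
regime `lo < K ≤ 3lo/2` (e.g. `R²(R³)`, `R³(R⁴)`, `R⁴(R⁵)`, `R⁴(R⁶)`, `R⁶(R⁷..R⁹)`) is exactly where the cost-free near certificate works at EVERY width
`j ≥ 2` (`(3lo − K)j ≥ 2K` at `j = 2`); the glued child `(lo,K) = (1,2)` has `K = 2lo` and needed widths 2, 3 by hand (g30).  Far-giant pieces here have
`γ ≥ lo/K ≥ 2/3`, so the route bound constant is `R = 2·min odds ≥ 2`, and `x(1+R) ≤ R` follows from `x(lo+K) ≤ lo + Kγ` and `lo ≤ Kγ`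
(`(lo + Kγ)(1+γ) ≤ 2γ(lo+K) ⟺ lo(1−γ) ≤ Kγ(1−γ)`).
* `shape_chain` (the binomial chain on the progression `lo·j + K·i`), **`sHub_routeBound`** (`2o·u(l) ≤ u(l + Kr)` for charged `l` with
  `2l < (lo+K)j`, `r ≥ 1`, `2Kr + 6l < 3(lo+K)j + 2K`; index bookkeeping: `6s < j`, `2r + 6s < j + 2` after cancelling `K`), `shape_sum_bounds`;
* **`sdec_sHub`** — `lo < K`, `2K ≤ 3lo`; ∀ `P` with `2 ≤ |P|` and `lo ≤ Kγ`, `γ < 1`, `x(lo+K) ≤ lo + Kγ` for `γ ∈ P`; `0 < x` ⟹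
  **`SDEC x ((lo+K)|P|) (sHub lo K P)`**.
Numerics: memo §3 / kit j290495 (shapes (2,3), (3,4), (4,5), (4,6): cost-free certificate feasible at every width tested; exact).

HONEST STATUS.  A shape-general SDEC family of hubs (the cores of forests of glued siblings `R^lo(R^K)`, `K ≤ 3lo/2`; the forest assembly needs ONE
piece ∗ one blob by a torque-cost certificate — memo §3, not here); `SiblingStep`, `GluedDominated'`, `SDECConvClosed`, `FarTreeRow` OPEN; RATE class
(log\*) / honest sentence of `run/shared/lean/prim/quant/README.md` unchanged.  [this work].  Nothing here is cited as a published result.  The gluing rows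
served [cite: KozmaNitzan2024, Conjecture 3 (p. 15)]; product measure [cite: Grimmett1999, §1.3 p. 10].
-/

noncomputable section

open scoped BigOperators

namespace Summit.CriticalPhenomena.PercolationContinuityZ3.Theorems
namespace Quant
namespace LawDec

open Finset

/-! ### From likelihood-ratio dominance to the route bound, on the progression `lo·j + K·i` -/

/-- **the chain on the progression `lo·j + K·i`**: `C(j,s)·u_m ≥ o·C(j,m)·u_s` for `s < m ≤ j` (`o ≥ 1`, `u ≥ 0`). [this work] -/
theorem shape_chain (lo K : ℕ) (o : ℝ) (ho1 : 1 ≤ o) (j : ℕ) (u : ℕ → ℝ) (hu0 : ∀ h, 0 ≤ u h)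
    (hlr : ∀ i : ℕ, o * ((j : ℝ) - i) * u (lo * j + K * i) ≤ ((i : ℝ) + 1) * u (lo * j + K * (i + 1))) (s : ℕ) :
    ∀ m : ℕ, s + 1 ≤ m → m ≤ j → o * (j.choose m : ℝ) * u (lo * j + K * s) ≤ (j.choose s : ℝ) * u (lo * j + K * m) := by
  refine Nat.le_induction ?_ ?_
  · intro hsj
    have h := hlr s
    have e := Nat.choose_succ_right_eq j s
    have e' : ((j.choose (s + 1) : ℕ) : ℝ) * ((s : ℝ) + 1) = (j.choose s : ℝ) * ((j : ℝ) - s) := by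
      have : ((j.choose (s + 1) * (s + 1) : ℕ) : ℝ) = ((j.choose s * (j - s) : ℕ) : ℝ) := by rw [e]
      push_cast at this
      rw [Nat.cast_sub (by omega)] at this
      exact this
    have hs0 : (0 : ℝ) < (s : ℝ) + 1 := by positivity
    have h2 := mul_le_mul_of_nonneg_left h (Nat.cast_nonneg (j.choose s))
    have : ((s : ℝ) + 1) * (o * (j.choose (s + 1) : ℝ) * u (lo * j + K * s)) ≤ ((s : ℝ) + 1) * ((j.choose s : ℝ) * u (lo * j + K * (s + 1))) :=
      calc ((s : ℝ) + 1) * (o * (j.choose (s + 1) : ℝ) * u (lo * j + K * s))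
          = o * u (lo * j + K * s) * ((j.choose (s + 1) : ℝ) * ((s : ℝ) + 1)) := by ring
        _ = o * u (lo * j + K * s) * ((j.choose s : ℝ) * ((j : ℝ) - s)) := by rw [e']
        _ = (j.choose s : ℝ) * (o * ((j : ℝ) - s) * u (lo * j + K * s)) := by ring
        _ ≤ (j.choose s : ℝ) * (((s : ℝ) + 1) * u (lo * j + K * (s + 1))) := h2
        _ = ((s : ℝ) + 1) * ((j.choose s : ℝ) * u (lo * j + K * (s + 1))) := by ring
    exact le_of_mul_le_mul_left this hs0
  · intro m hsm ih hmj
    have ih' := ih (by omega)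
    have h := hlr m
    have e := Nat.choose_succ_right_eq j m
    have e' : ((j.choose (m + 1) : ℕ) : ℝ) * ((m : ℝ) + 1) = (j.choose m : ℝ) * ((j : ℝ) - m) := by
      have : ((j.choose (m + 1) * (m + 1) : ℕ) : ℝ) = ((j.choose m * (j - m) : ℕ) : ℝ) := by rw [e]
      push_cast at this
      rw [Nat.cast_sub (by omega)] at this
      exact this
    have hm0 : (0 : ℝ) < (m : ℝ) + 1 := by positivity
    have hjm : (0 : ℝ) ≤ (j : ℝ) - m := by
      have : (m : ℝ) ≤ j := by exact_mod_cast (by omega : m ≤ j)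
      linarith
    have hcs : (0 : ℝ) ≤ (j.choose s : ℝ) := Nat.cast_nonneg _
    have hcm : (0 : ℝ) ≤ (j.choose m : ℝ) := Nat.cast_nonneg _
    have ho0 : (0 : ℝ) ≤ o * ((j : ℝ) - m) := mul_nonneg (by linarith) hjm
    have h2 := mul_le_mul_of_nonneg_left h hcs
    have h3 := mul_le_mul_of_nonneg_left ih' ho0
    have h4 : (j.choose m : ℝ) * u (lo * j + K * s) ≤ o * (j.choose m : ℝ) * u (lo * j + K * s) := by
      have := mul_nonneg (show (0 : ℝ) ≤ o - 1 by linarith) (mul_nonneg hcm (hu0 (lo * j + K * s)))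
      nlinarith
    have h4' := mul_le_mul_of_nonneg_left h4 ho0
    have : ((m : ℝ) + 1) * (o * (j.choose (m + 1) : ℝ) * u (lo * j + K * s)) ≤ ((m : ℝ) + 1) * ((j.choose s : ℝ) * u (lo * j + K * (m + 1))) :=
      calc ((m : ℝ) + 1) * (o * (j.choose (m + 1) : ℝ) * u (lo * j + K * s))
          = o * u (lo * j + K * s) * ((j.choose (m + 1) : ℝ) * ((m : ℝ) + 1)) := by ring
        _ = o * u (lo * j + K * s) * ((j.choose m : ℝ) * ((j : ℝ) - m)) := by rw [e']
        _ = o * ((j : ℝ) - m) * ((j.choose m : ℝ) * u (lo * j + K * s)) := by ring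
        _ ≤ o * ((j : ℝ) - m) * (o * (j.choose m : ℝ) * u (lo * j + K * s)) := h4'
        _ ≤ o * ((j : ℝ) - m) * ((j.choose s : ℝ) * u (lo * j + K * m)) := h3
        _ = (j.choose s : ℝ) * (o * ((j : ℝ) - m) * u (lo * j + K * m)) := by ring
        _ ≤ (j.choose s : ℝ) * (((m : ℝ) + 1) * u (lo * j + K * (m + 1))) := h2
        _ = ((m : ℝ) + 1) * ((j.choose s : ℝ) * u (lo * j + K * (m + 1))) := by ring
    exact le_of_mul_le_mul_left this hm0

/-- **THE ROUTE BOUND for the hub of shape `(lo, K)`** (`lo < K`, `2K ≤ 3lo`, `|P| ≥ 2`, `1 ≤ o ≤` every odds): for every charged `l` with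
`2l < (lo+K)|P|` and every `r ≥ 1` with `2Kr + 6l < 3(lo+K)|P| + 2K`: `2o·u(l) ≤ u(l + Kr)`. [this work] -/
theorem sHub_routeBound (lo K : ℕ) (hloK : lo < K) (hK : 2 * K ≤ 3 * lo) (o : ℝ) (ho1 : 1 ≤ o) (P : List ℝ)
    (hP : ∀ γ ∈ P, 0 ≤ γ ∧ γ ≤ 1 ∧ o * (1 - γ) ≤ γ) (hj : 2 ≤ P.length)
    (l r : ℕ) (hl : sHub lo K P l ≠ 0) (h2l : 2 * l < (lo + K) * P.length) (hr : 1 ≤ r)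
    (h4 : 2 * (K * r) + 6 * l < 3 * ((lo + K) * P.length) + 2 * K) :
    2 * o * sHub lo K P l ≤ sHub lo K P (l + K * r) := by
  obtain ⟨hsupp, hlr⟩ := sHub_struct lo K hloK o (by linarith) P hP
  obtain ⟨a0, _, _, _⟩ := sHub_laws lo K P (fun γ' h' => ⟨(hP γ' h').1, (hP γ' h').2.1⟩)
  set j : ℕ := P.length with hj'
  obtain ⟨s, rfl, hsj⟩ := hsupp l hl
  -- index bookkeeping: cancel `K`
  have hKpos : 0 < K := lt_of_le_of_lt (Nat.zero_le lo) hloK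
  have e1 : (lo + K) * j = lo * j + K * j := by ring
  rw [e1] at h2l h4
  have hKj : 2 * (K * j) ≤ 3 * (lo * j) := by
    have := Nat.mul_le_mul_right j hK
    calc 2 * (K * j) = 2 * K * j := by ring
      _ ≤ 3 * lo * j := this
      _ = 3 * (lo * j) := by ring
  have h6 : K * (6 * s) < K * j := by
    have : 6 * (K * s) < K * j := by omega
    calc K * (6 * s) = 6 * (K * s) := by ring
      _ < K * j := this
  have hs6 : 6 * s < j := Nat.lt_of_mul_lt_mul_left h6
  have hB : K * (2 * r + 6 * s) < K * (j + 2) := by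
    have : 2 * (K * r) + 6 * (K * s) < K * j + 2 * K := by omega
    calc K * (2 * r + 6 * s) = 2 * (K * r) + 6 * (K * s) := by ring
      _ < K * j + 2 * K := this
      _ = K * (j + 2) := by ring
  have hrs : 2 * r + 6 * s < j + 2 := Nat.lt_of_mul_lt_mul_left hB
  have hsr : s + r + s + 1 ≤ j := by omega
  have h3s : 3 * s + 2 ≤ j := by omega
  -- dominance steps in `s`-indexing
  have hlr' : ∀ i : ℕ, o * ((j : ℝ) - i) * sHub lo K P (lo * j + K * i) ≤ ((i : ℝ) + 1) * sHub lo K P (lo * j + K * (i + 1)) := by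
    intro i
    have := hlr (lo * j + K * i)
    push_cast at this
    have hK0 : (0 : ℝ) < K := by exact_mod_cast hKpos
    have e1 : o * (((lo : ℝ) + K) * j - ((lo : ℝ) * j + K * i)) = K * (o * ((j : ℝ) - i)) := by ring
    have e2 : ((lo : ℝ) * j + K * i + K - (lo : ℝ) * j) = K * ((i : ℝ) + 1) := by ring
    rw [e1, e2, show lo * j + K * i + K = lo * j + K * (i + 1) by ring] at this
    have hu := a0 (lo * j + K * i)
    have hu' := a0 (lo * j + K * (i + 1))
    -- divide by `K > 0`
    have : K * (o * ((j : ℝ) - i) * sHub lo K P (lo * j + K * i)) ≤ K * (((i : ℝ) + 1) * sHub lo K P (lo * j + K * (i + 1))) := by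
      nlinarith
    exact le_of_mul_le_mul_left this hK0
  have chain := shape_chain lo K o ho1 j (sHub lo K P) a0 hlr' s (s + r) (by omega) (by omega)
  have hc1 : j.choose (s + 1) ≤ j.choose (s + r) := choose_ge_of_between j s (s + r) (by omega) (by omega)
  have hc2 : 2 * j.choose s ≤ j.choose (s + 1) := by
    have e := Nat.choose_succ_right_eq j s
    have hss : 2 * (s + 1) ≤ j - s := by omega
    have h1 : (2 * j.choose s) * (s + 1) ≤ j.choose (s + 1) * (s + 1) := by
      rw [e, Nat.mul_comm 2, Nat.mul_assoc]
      exact Nat.mul_le_mul_left _ hss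
    exact Nat.le_of_mul_le_mul_right h1 (Nat.succ_pos s)
  have hc : (2 : ℝ) * (j.choose s : ℝ) ≤ (j.choose (s + r) : ℝ) := by exact_mod_cast hc2.trans hc1
  have hcs : (0 : ℝ) < (j.choose s : ℝ) := by exact_mod_cast Nat.choose_pos (by omega)
  rw [show lo * j + K * s + K * r = lo * j + K * (s + r) by ring]
  have hus := a0 (lo * j + K * s)
  have ho0 : 0 ≤ o * sHub lo K P (lo * j + K * s) := mul_nonneg (by linarith) hus
  have : (j.choose s : ℝ) * (2 * o * sHub lo K P (lo * j + K * s)) ≤ (j.choose s : ℝ) * sHub lo K P (lo * j + K * (s + r)) :=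
    calc (j.choose s : ℝ) * (2 * o * sHub lo K P (lo * j + K * s)) = (2 * (j.choose s : ℝ)) * (o * sHub lo K P (lo * j + K * s)) := by ring
      _ ≤ (j.choose (s + r) : ℝ) * (o * sHub lo K P (lo * j + K * s)) := mul_le_mul_of_nonneg_right hc ho0
      _ = o * (j.choose (s + r) : ℝ) * sHub lo K P (lo * j + K * s) := by ring
      _ ≤ (j.choose s : ℝ) * sHub lo K P (lo * j + K * (s + r)) := chain
  exact le_of_mul_le_mul_left this hcs

/-! ### The hub of every width is SDEC -/

/-- sums over the list: lower and upper bounds termwise. [this work] -/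
theorem shape_sum_bounds (lo K : ℕ) (x : ℝ) : ∀ P : List ℝ, (∀ γ ∈ P, γ < 1 ∧ x * ((lo : ℝ) + K) ≤ lo + K * γ) →
    x * ((lo : ℝ) + K) * (P.length : ℝ) ≤ (P.map (fun γ => (lo : ℝ) + K * γ)).sum ∧
      (P ≠ [] → 0 < K → (P.map (fun γ => (lo : ℝ) + K * γ)).sum < ((lo : ℝ) + K) * (P.length : ℝ))
  | [], _ => by simp
  | γ :: P, hP => by
    have hγ := hP γ (by simp)
    have ih := shape_sum_bounds lo K x P (fun γ' h' => hP γ' (List.mem_cons_of_mem γ h'))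
    simp only [List.map_cons, List.sum_cons, List.length_cons, Nat.cast_succ]
    refine ⟨by linarith [ih.1], fun _ hK0 => ?_⟩
    have hKr : (0 : ℝ) < K := by exact_mod_cast hK0
    have hKγ : (K : ℝ) * γ < K := by nlinarith [hγ.1]
    rcases eq_or_ne P [] with hn | hn
    · subst hn; simp; linarith
    · have := ih.2 hn hK0; linarith

/-- **THE SUB-FLOOR HUB OF SHAPE `(lo, K)`, `lo < K ≤ 3lo/2`, OF EVERY WIDTH IS SDEC.**  For every list `P` of `j ≥ 2` gates with `lo ≤ Kγ` (far-giant),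
`γ < 1` and `x(lo+K) ≤ lo + Kγ` (affordable) for `γ ∈ P`, and every floor `0 < x`: `SDEC x ((lo+K)j) (sHub lo K P)`. [this work] -/
theorem sdec_sHub (lo K : ℕ) (hloK : lo < K) (hK : 2 * K ≤ 3 * lo) {x : ℝ} (hx0 : 0 < x) :
    ∀ P : List ℝ, 2 ≤ P.length → (∀ γ ∈ P, (lo : ℝ) ≤ K * γ ∧ γ < 1 ∧ x * ((lo : ℝ) + K) ≤ lo + K * γ) →
    SDEC x ((lo + K) * P.length) (sHub lo K P) := by
  intro P hP2 hP
  have hKpos : 0 < K := lt_of_le_of_lt (Nat.zero_le lo) hloK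
  have hKr : (0 : ℝ) < K := by exact_mod_cast hKpos
  have hloR : (0 : ℝ) ≤ lo := Nat.cast_nonneg lo
  have hK32 : 2 * (K : ℝ) ≤ 3 * lo := by exact_mod_cast hK
  have hne : P ≠ [] := by rintro rfl; simp at hP2
  obtain ⟨γ₀, hγ₀⟩ := List.exists_mem_of_ne_nil P hne
  have hx1 : x < 1 := by
    obtain ⟨_, g2, g3⟩ := hP γ₀ hγ₀
    nlinarith
  -- every piece gate is `≥ 2/3`
  have hhalf : ∀ γ ∈ P, 2 / 3 ≤ γ := by
    intro γ h
    have := (hP γ h).1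
    nlinarith
  set j : ℕ := P.length with hjP
  have hP01 : ∀ γ ∈ P, 0 ≤ γ ∧ γ ≤ 1 := fun γ h => ⟨by linarith [hhalf γ h], (hP γ h).2.1.le⟩
  obtain ⟨a0, aM, a1, am⟩ := sHub_laws lo K P hP01
  set T₀ : ℝ := (P.map (fun γ => (lo : ℝ) + K * γ)).sum with hT₀
  obtain ⟨hlo', hhi'⟩ := shape_sum_bounds lo K x P (fun γ h => ⟨(hP γ h).2.1, (hP γ h).2.2⟩)
  have hTtop : T₀ < ((lo : ℝ) + K) * j := hhi' hne hKpos
  have hj2 : (2 : ℝ) ≤ j := by exact_mod_cast hP2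
  have hT0 : 0 < T₀ := by
    have : 0 < x * ((lo : ℝ) + K) * (j : ℝ) := by positivity
    linarith
  -- the constant `o = max(1, x/(2(1−x)))`
  set o : ℝ := max 1 (x / (2 * (1 - x))) with ho
  have ho1 : 1 ≤ o := le_max_left _ _
  have hodds : ∀ γ ∈ P, 0 ≤ γ ∧ γ ≤ 1 ∧ o * (1 - γ) ≤ γ := by
    intro γ h
    obtain ⟨g1, g2, g3⟩ := hP γ h
    have gh := hhalf γ h
    refine ⟨by linarith, g2.le, ?_⟩
    rw [ho, max_mul_of_nonneg _ _ (by linarith : (0 : ℝ) ≤ 1 - γ)]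
    refine max_le (by linarith) ?_
    -- `x(1−γ) ≤ 2γ(1−x)` from `x(lo+K) ≤ lo + Kγ ≤ 2γ(lo+K)/(1+γ)`
    have key : ((lo : ℝ) + K * γ) * (1 + γ) ≤ 2 * γ * ((lo : ℝ) + K) := by nlinarith
    have hx2 : x * (1 + γ) ≤ 2 * γ := by
      have h1 : x * ((lo : ℝ) + K) * (1 + γ) ≤ ((lo : ℝ) + K * γ) * (1 + γ) := mul_le_mul_of_nonneg_right g3 (by linarith)
      have hlK : (0 : ℝ) < (lo : ℝ) + K := by linarith
      nlinarith
    rw [div_mul_eq_mul_div, div_le_iff₀ (by linarith)]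
    nlinarith
  have hxR : x * (1 + 2 * o) ≤ 2 * o := by
    have : x / (2 * (1 - x)) ≤ o := le_max_right _ _
    rw [div_le_iff₀ (by linarith)] at this
    nlinarith
  obtain ⟨hsupp, _⟩ := sHub_struct lo K hloK o (by linarith) P hodds
  refine sdec_progressionLK lo K j x T₀ (2 * o) (sHub lo K P) hloK hK hP2 hx0 hx1 a0 aM a1 am hT0 hTtop
    (by push_cast; nlinarith [hlo']) ?_ (by linarith) hxR ?_
  · intro h hh
    obtain ⟨s, hs, _⟩ := hsupp h hh
    exact ⟨s, hs⟩
  · intro l r _ hlT hμl hr h4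
    have h2l : 2 * l < (lo + K) * j := by
      have : (2 : ℝ) * l < ((lo : ℝ) + K) * j := by linarith
      exact_mod_cast this
    have h4' : 2 * (K * r) + 6 * l < 3 * ((lo + K) * j) + 2 * K := by
      have : (2 : ℝ) * (K * r) + 6 * l < 3 * (((lo : ℝ) + K) * j) + 2 * K := by nlinarith
      exact_mod_cast this
    have := sHub_routeBound lo K hloK hK o ho1 P hodds hP2 l r hμl.ne' h2l hr h4'
    linarith

end LawDec
end Quant
end Summit.CriticalPhenomena.PercolationContinuityZ3.Theorems
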